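import Literature.NumberTheory.LFunctions.MontgomeryOdlyzkoLimitation
import Literature.NumberTheory.LFunctions.BondarenkoHeap2026Prop1Proofs
import Literature.NumberTheory.LFunctions.BondarenkoHeap2026Section2Proofs
import Literature.NumberTheory.LFunctions.BondarenkoHeap2026DiagonalProofs
import HarnessLib

/-!
# The Montgomery–Odlyzko criterion (1984), small-gap half, margin form — PROVED via BH26 §2

NOT RH-BEARING; bears_on: LADDER-RH §4 HELD «conditional bridges: exceptional zero ⇒ …» (cell
rh-crit C5 `ah`, row «MO-CRIT-BH»). RH is the HYPOTHESIS of the one public theorem of this file;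
nothing here bears on the truth of RH.

## What is proved

`montgomeryOdlyzko1984_criterion_of_margin` — the «`h(c) > 1 ⇒ μ ≤ c`» half of the
Montgomery–Odlyzko resonance method [MontgomeryOdlyzko1984], in the vocabulary of the landau-siegel
statement file `MontgomeryOdlyzkoLimitation.lean` (`coeffNormSq`, `resonatorLength δ T = ⌊T^{1−δ}⌋`,
`moFunctional c a L T = c − Re moForm(a, L, 2πc/log T)/Σ|a_k|²`), in MARGIN form: on RH, if for some
`0 < δ < 1`, `c > 0`, `η > 0` and some family of coefficients `a_T` one has, for all large `T`,
`Σ_{k ≤ y}|a_T(k)|² > 0` and `h(c) ≥ 1 + η` with `y = ⌊T^{1−δ}⌋`, then `ZetaGapLiminfLe c` (`μ ≤ c`,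
the non-strict reading, as printed: "Montgomery and Odlyzko proved that if `h(c)>1` for all
sufficiently large `T` for some choice of `a_k`'s, `c`, and a small `δ`, then assuming RH we have
`μ ≤ c`" [cite: GoldstonTrudgianTurnageButterbaugh2023, §1 — held text `paper:arxiv-2201.10676`
p0003:L28]).

## What is NOT proved (finding F-MO-1, recorded on the cell board by t3 g4 / lead g6 R-g6-44)

The landau-siegel named fact `montgomeryOdlyzko1984_criterion` (same file, AS TYPED: `1 < h(c)`
pointwise in `T`, coefficients depending on `T`) is NOT discharged here and no `−1` is claimed on
either ledger: with a `T`-dependent family the excess `h(c) − 1` may tend to `0` faster than the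
method's error terms (`O(ε I₀) + O(1/T)` below, `O(y/T) + o(1)` in the original), so the pointwise
typing is stronger than what the method gives; the uniform margin `η` is exactly what it supports
(once the coefficients are normalised the constants depend on `c, δ, η` only). This file is an
ENABLER: the `μ`-records (MO84 `0.5179`, CGG84 `0.5172`, BMN10, FW12, Pr16) need, in addition,
the asymptotics of their specific coefficient sums, which are not formalised here.

## Road (Bondarenko–Heap 2026 §2 in place of Montgomery–Odlyzko's sharp count; all inputs are
tree theorems)

Montgomery–Odlyzko count pairs of zeros in `[T, 2T]` with a sharp cut-off; Bondarenko–Heap [BH26,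
§2] weigh the same resonance sums with the non-negative window `Φ = φ ∗ φ`, `W_T`, whose Fourier
transform `Ŵ_T` has compact support (BH (2)). For a `lim inf` statement the choice of a
non-negative weight concentrated at height `≍ T` is immaterial — one needs ONE close pair of
ordinates near height `T` for a sequence of `T → ∞` — so we run MO's criterion through BH's
machinery, every piece of which is already a theorem of this tree:
1. (§1, mediant) `Re moForm(u + iv) = Re moForm(u) + Re moForm(v)` and `Σ|u+iv|² = Σu² + Σv²`
   (the kernel `Λ(k) sin(h log k)/(√k log k)` is real), so a complex family with margin `η` yields
   a REAL sequence `b` with `Σ b² > 0` and the same margin (`MOC.exists_real_of_margin`);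
2. (§3, normalisation) `r(n) = λ b(n) √n` on `[1, y]`, `0` elsewhere, with `λ > 0` so small that
   `|r(n)| ≤ n^ε`, and then `Σ_{n ≤ y} r(n)²/n = λ² Σ b² ≥ 1/y` is arranged by the choice
   `λ = min(…)` (`MOC.exists_admissible`); the diagonal sums are `λ² Σ b²` and
   `λ² (π/2) Re moForm(b)` (`MOC.normSum_eq`, `MOC.diagSum_eq`);
3. (§2, short resonators) for `y ≤ T^{1−δ}` and `T^δ ≥ 16πσ` one has `4πσ(y+1) < T`, and since
   `|log(p/n)| ≥ 1/(y+1)` for positive integers `p ≠ n ≤ y`, the support bound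
   `weightHat_support_holds` kills EVERY off-diagonal term of BH's `I₀` and `S` (BH (8)–(10)):
   `I₀ = Ŵ_T(0) Σ r²/n` (`MOC.I0R_eq_diag`), `S = Ŵ_T(0) Σ_n Σ_{k∣n} Λ(k) g(k) r(n/k) r(n)/n`
   (`MOC.primeSum_eq_diag`); hence `c I₀ − (2/π) S = I₀ · h(c; b) ≥ (1 + η) I₀`, and
   `Ŵ_T(0) ≥ C_Φ T/2` (`weightHat_zero_holds`, `cPhi_pos_holds`) gives `I₀ ≥ 1`;
4. BH Proposition 1 (`proposition1_holds`, on RH, with `ε ≤ η/8`): `I₁ ≥ (1 + η/2) I₀`; the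
   extension lemma (`extensionToLine_holds`) moves this to the full-line integrals `I₀(ε), I₁(ε)`
   over `[T^{1−ε}, T^{1+ε}]`, so `I₁(ε) > I₀(ε)`; the small-gaps criterion (`smallGaps_criterion`)
   then produces consecutive ordinates `γ_m < γ_{m+1} ≤ γ_m + 2πc/log T` with `γ_m ≥ √T − 4`, i.e.
   (`Assembly.gapBound_le`) a normalised gap `≤ c(1 + 2ε) < c'`, and `(γ_N + 4)² ≤ T` forces
   `m > N` (`zetaOrdinate_mono_holds`) — this is `∃ᶠ m, zetaNormalizedGap m ≤ c(1+2ε)`;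
5. `c' ≥ 1` is Selberg–Fujii (`zetaGapLiminfBelow_one`), so WLOG `c < c' < 1`.
Theorems only: 0 `def`, 0 named facts, 0 `sorry`, no `kit` certificate; helpers are `private`
(namespace `MOC`). One `set_option maxHeartbeats 400000 in` on the ≈200-line assembly.

## References

* [MontgomeryOdlyzko1984] H. L. Montgomery, A. M. Odlyzko, *Gaps between zeros of the zeta
  function*, in: Topics in Classical Number Theory (Budapest 1981), Colloq. Math. Soc. János Bolyai
  34, North-Holland 1984, 1079–1106 — the method and the criterion.
* [GoldstonTrudgianTurnageButterbaugh2023] D. A. Goldston, T. S. Trudgian, C. L. Turnage-Butterbaugh,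
  *A limitation of the Montgomery–Odlyzko method …*, J. Math. Anal. Appl. 527 (2023) 127548,
  arXiv:2201.10676 — §1 restates the criterion (the statement typed by landau-siegel).
* [BondarenkoHeap2026] A. Bondarenko, W. Heap, *Small gaps between zeros of the zeta function …*
  (2026) — §2: the window `W_T`, (2), (8)–(10), Proposition 1, the extension lemma and the
  small-gaps criterion (tree files `BondarenkoHeap2026*.lean`).
* [ConreyGhoshGonek1984] J. B. Conrey, A. Ghosh, S. M. Gonek, Bull. London Math. Soc. 16 (1984)
  421–424 — the `M₂/M₁` form of the same method (the road of the sibling large-gap file).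
-/

noncomputable section

open Real Filter MeasureTheory Set Finset
open scoped Topology ArithmeticFunction.vonMangoldt

namespace Literature.NumberTheory.LFunctions

namespace MOC

open BondarenkoHeap2026 GoldstonTrudgianTurnageButterbaugh2023

/-! ### §1 Complex coefficients reduce to real ones -/

/-- `Re moForm(f) = Re moForm(Re f) + Re moForm(Im f)` (the kernel `Λ(k) sin(…)/(√k log k)` is
real). [folklore] -/
private theorem re_moForm_eq_add (f : ℕ → ℂ) (L : ℕ) (h : ℝ) :
    (InoueKobayashiToma2025.moForm f L h).re
      = (InoueKobayashiToma2025.moForm (fun n => ((f n).re : ℂ)) L h).re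
        + (InoueKobayashiToma2025.moForm (fun n => ((f n).im : ℂ)) L h).re := by
  unfold InoueKobayashiToma2025.moForm
  have h2π : (2 / π : ℂ) = ((2 / π : ℝ) : ℂ) := by push_cast; rfl
  rw [h2π, Complex.re_ofReal_mul, Complex.re_ofReal_mul, Complex.re_ofReal_mul, ← mul_add,
    Complex.re_sum, Complex.re_sum, Complex.re_sum, ← Finset.sum_add_distrib]
  congr 1
  refine Finset.sum_congr rfl fun n _ => ?_
  rw [Complex.re_sum, Complex.re_sum, Complex.re_sum, ← Finset.sum_add_distrib]
  refine Finset.sum_congr rfl fun k _ => ?_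
  simp only [Complex.mul_re, Complex.im_ofReal_mul, Complex.ofReal_re,
    Complex.ofReal_im, Complex.conj_re, Complex.conj_im, mul_zero]
  ring

/-- `Σ ‖f n‖² = Σ (Re f n)² + Σ (Im f n)²`. [folklore] -/
private theorem coeffNormSq_eq_add (f : ℕ → ℂ) (L : ℕ) :
    coeffNormSq f L = coeffNormSq (fun n => ((f n).re : ℂ)) L
      + coeffNormSq (fun n => ((f n).im : ℂ)) L := by
  unfold coeffNormSq
  rw [← Finset.sum_add_distrib]
  refine Finset.sum_congr rfl fun n _ => ?_
  rw [Complex.norm_real, Complex.norm_real, Real.norm_eq_abs, Real.norm_eq_abs, sq_abs, sq_abs,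
    Complex.sq_norm, Complex.normSq_apply]
  ring

/-- A coefficient sequence with zero norm on `[1, L]` has zero bilinear form. [folklore] -/
private theorem moForm_eq_zero_of_coeffNormSq_eq_zero {b : ℕ → ℂ} {L : ℕ} (h : ℝ)
    (hN : coeffNormSq b L = 0) : InoueKobayashiToma2025.moForm b L h = 0 := by
  unfold coeffNormSq at hN
  have hz : ∀ n ∈ Finset.Icc 1 L, b n = 0 := by
    have := (Finset.sum_eq_zero_iff_of_nonneg fun n _ => sq_nonneg ‖b n‖).mp hN
    intro n hn
    have h1 := this n hn
    rwa [sq_eq_zero_iff, norm_eq_zero] at h1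
  unfold InoueKobayashiToma2025.moForm
  rw [Finset.sum_eq_zero fun n hn => ?_, mul_zero]
  exact Finset.sum_eq_zero fun k _ => by rw [hz n hn, map_zero, mul_zero]

/-- The mediant step: if `c − Re moForm(f)/N(f) ≥ 1 + η` with `N(f) > 0`, then the same holds
for the real part or for the imaginary part of `f` (whichever has positive norm and the
inequality). [folklore] -/
private theorem exists_real_of_margin {f : ℕ → ℂ} {L : ℕ} {h c η : ℝ}
    (hN : 0 < coeffNormSq f L)
    (hm : 1 + η ≤ c - (InoueKobayashiToma2025.moForm f L h).re / coeffNormSq f L) :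
    ∃ b : ℕ → ℝ, 0 < coeffNormSq (fun n => (b n : ℂ)) L ∧
      1 + η ≤ c - (InoueKobayashiToma2025.moForm (fun n => (b n : ℂ)) L h).re
        / coeffNormSq (fun n => (b n : ℂ)) L := by
  set u : ℕ → ℝ := fun n => (f n).re
  set v : ℕ → ℝ := fun n => (f n).im
  set Mu := (InoueKobayashiToma2025.moForm (fun n => (u n : ℂ)) L h).re with hMu
  set Mv := (InoueKobayashiToma2025.moForm (fun n => (v n : ℂ)) L h).re with hMv
  set Nu := coeffNormSq (fun n => (u n : ℂ)) L with hNu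
  set Nv := coeffNormSq (fun n => (v n : ℂ)) L with hNv
  have hM : (InoueKobayashiToma2025.moForm f L h).re = Mu + Mv := re_moForm_eq_add f L h
  have hNN : coeffNormSq f L = Nu + Nv := coeffNormSq_eq_add f L
  have hNu0 : 0 ≤ Nu := coeffNormSq_nonneg _ _
  have hNv0 : 0 ≤ Nv := coeffNormSq_nonneg _ _
  set κ := 1 + η - c with hκ
  -- clear denominators in the hypothesis
  have hm' : κ * (Nu + Nv) ≤ -(Mu + Mv) := by
    rw [hM, hNN] at hm
    rw [hNN] at hN
    have h2 : (Mu + Mv) / (Nu + Nv) ≤ c - (1 + η) := by linarith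
    rw [div_le_iff₀ hN] at h2
    rw [hκ]; linarith
  -- the conclusion from `κ N ≤ -M`, `N > 0`
  have concl : ∀ {b : ℕ → ℝ}, 0 < coeffNormSq (fun n => (b n : ℂ)) L →
      κ * coeffNormSq (fun n => (b n : ℂ)) L
        ≤ -(InoueKobayashiToma2025.moForm (fun n => (b n : ℂ)) L h).re →
      1 + η ≤ c - (InoueKobayashiToma2025.moForm (fun n => (b n : ℂ)) L h).re
        / coeffNormSq (fun n => (b n : ℂ)) L := by
    intro b hb hk
    have : (InoueKobayashiToma2025.moForm (fun n => (b n : ℂ)) L h).re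
        / coeffNormSq (fun n => (b n : ℂ)) L ≤ c - (1 + η) := by
      rw [div_le_iff₀ hb, hκ] at *; linarith
    linarith
  -- case analysis
  rcases hNu0.eq_or_lt with hNu_zero | hNu_pos
  · -- `u ≡ 0` on `[1, L]`: then `Mu = 0` and `v` carries everything
    have hMu0 : Mu = 0 := by
      rw [hMu, moForm_eq_zero_of_coeffNormSq_eq_zero h hNu_zero.symm, Complex.zero_re]
    have hNv_pos : 0 < Nv := by rw [hNN] at hN; linarith
    refine ⟨v, hNv_pos, concl hNv_pos ?_⟩
    rw [← hNu_zero, hMu0] at hm'; simpa using hm'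
  rcases hNv0.eq_or_lt with hNv_zero | hNv_pos
  · have hMv0 : Mv = 0 := by
      rw [hMv, moForm_eq_zero_of_coeffNormSq_eq_zero h hNv_zero.symm, Complex.zero_re]
    refine ⟨u, hNu_pos, concl hNu_pos ?_⟩
    rw [← hNv_zero, hMv0] at hm'; simpa using hm'
  by_cases hu : κ * Nu ≤ -Mu
  · exact ⟨u, hNu_pos, concl hNu_pos hu⟩
  · refine ⟨v, hNv_pos, concl hNv_pos ?_⟩
    push Not at hu
    show κ * Nv ≤ -Mv
    linarith

/-! ### §2 Separation of the off-diagonal terms for short resonators -/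

/-- For positive integers `p ≠ n` with `n ≤ L`: `|log(p/n)| ≥ 1/(L+1)`. [folklore] -/
private theorem abs_log_div_ge {p n L : ℕ} (hp : 1 ≤ p) (hn : 1 ≤ n) (hnL : n ≤ L) (hpn : p ≠ n) :
    1 / ((L : ℝ) + 1) ≤ |Real.log ((p : ℝ) / n)| := by
  have hn0 : (0 : ℝ) < n := by exact_mod_cast hn
  have hp0 : (0 : ℝ) < p := by exact_mod_cast hp
  have hL1 : (n : ℝ) ≤ L := by exact_mod_cast hnL
  rcases lt_or_gt_of_ne hpn with hlt | hgt
  · -- `p < n`: `log(n/p) ≥ log(n/(n-1)) ≥ 1/n`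
    have hp1 : (p : ℝ) + 1 ≤ n := by exact_mod_cast hlt
    have hlog : Real.log ((p : ℝ) / n) ≤ -(1 / ((L : ℝ) + 1)) := by
      have h1 : Real.log ((p : ℝ) / n) = -Real.log ((n : ℝ) / p) := by
        rw [← Real.log_inv, inv_div]
      rw [h1, neg_le_neg_iff]
      have h2 : 1 - ((n : ℝ) / p)⁻¹ ≤ Real.log ((n : ℝ) / p) :=
        Real.one_sub_inv_le_log_of_pos (by positivity)
      rw [inv_div] at h2
      have h3 : 1 / ((L : ℝ) + 1) ≤ 1 - (p : ℝ) / n := by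
        have h4 : (p : ℝ) / n ≤ 1 - 1 / n := by
          rw [div_le_iff₀ hn0, sub_mul, one_div_mul_cancel hn0.ne']; linarith
        have h5 : 1 / ((L : ℝ) + 1) ≤ 1 / (n : ℝ) :=
          one_div_le_one_div_of_le hn0 (by linarith)
        linarith
      linarith
    have : Real.log ((p : ℝ) / n) < 0 := by
      have : 0 < 1 / ((L : ℝ) + 1) := by positivity
      linarith
    rw [abs_of_neg this]; linarith
  · -- `p > n`: `log(p/n) ≥ log((n+1)/n) ≥ 1/(n+1)`
    have hp1 : (n : ℝ) + 1 ≤ p := by exact_mod_cast hgt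
    have h2 : 1 - ((p : ℝ) / n)⁻¹ ≤ Real.log ((p : ℝ) / n) :=
      Real.one_sub_inv_le_log_of_pos (by positivity)
    rw [inv_div] at h2
    have h3 : 1 / ((L : ℝ) + 1) ≤ 1 - (n : ℝ) / p := by
      have h4 : (n : ℝ) / p ≤ 1 - 1 / ((n : ℝ) + 1) := by
        have h6 : (n : ℝ) / p ≤ n / (n + 1) := div_le_div_of_nonneg_left hn0.le (by positivity) hp1
        have h7 : (n : ℝ) / (n + 1) = 1 - 1 / ((n : ℝ) + 1) := by field_simp; ring
        linarith
      have h5 : 1 / ((L : ℝ) + 1) ≤ 1 / ((n : ℝ) + 1) :=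
        one_div_le_one_div_of_le (by positivity) (by linarith)
      linarith
    have hpos : 0 ≤ Real.log ((p : ℝ) / n) := by
      have : 0 < 1 / ((L : ℝ) + 1) := by positivity
      linarith
    rw [abs_of_nonneg hpos]; linarith

/-- **Off-diagonal vanishing.** If `4πσ(L+1) < T` then `Ŵ_T(log(p/n)/2π) = 0` for positive
integers `p ≠ n` with `n ≤ L` (by (2): `supp Ŵ_T ⊆ [−2σ/T, 2σ/T]`, tree theorem
`weightHat_support_holds`). [folklore] -/
private theorem weightHat_offDiag_eq_zero (w : Bump) (B : ℕ) {T : ℝ} {L p n : ℕ} (hT : 0 < T)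
    (hsep : 4 * π * w.σ * ((L : ℝ) + 1) < T) (hp : 1 ≤ p) (hn : 1 ≤ n) (hnL : n ≤ L)
    (hpn : p ≠ n) :
    weightHat w B T (Real.log ((p : ℝ) / n) / (2 * π)) = 0 := by
  have hσ := w.σ_pos
  have hlog := abs_log_div_ge hp hn hnL hpn
  have hξ : 2 * w.σ / T < |Real.log ((p : ℝ) / n) / (2 * π)| := by
    rw [abs_div, abs_of_pos (by positivity : (0 : ℝ) < 2 * π)]
    rw [div_lt_div_iff₀ hT (by positivity)]
    have h1 : 1 / ((L : ℝ) + 1) * T ≤ |Real.log ((p : ℝ) / n)| * T :=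
      mul_le_mul_of_nonneg_right hlog hT.le
    have h2 : 2 * w.σ * (2 * π) < 1 / ((L : ℝ) + 1) * T := by
      rw [one_div_mul_eq_div, lt_div_iff₀ (by positivity)]
      nlinarith
    linarith
  unfold weightHat
  rw [weightHat_support_holds w B T hT _ hξ, Complex.zero_re]

/-- **Diagonal form of `I₀`** for short resonators:
`I₀ = Ŵ_T(0) · Σ_{n ≤ L} r(n)²/n` when `4πσ(L+1) < T`. [folklore] -/
private theorem I0R_eq_diag (w : Bump) (B : ℕ) (r : ℕ → ℝ) {T : ℝ} {L : ℕ} (hT : 0 < T)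
    (hsep : 4 * π * w.σ * ((L : ℝ) + 1) < T) :
    I0R w B r L T = weightHat w B T 0 * ∑ n ∈ Finset.Icc 1 L, r n ^ 2 / n := by
  rw [I0R_eq_sum w B r L hT, Nat.floor_natCast, Finset.mul_sum]
  refine Finset.sum_congr rfl fun m hm => ?_
  have hm1 := (Finset.mem_Icc.mp hm).1
  have hmL := (Finset.mem_Icc.mp hm).2
  rw [Finset.sum_eq_single_of_mem m hm fun n hn hnm => ?_]
  · have hm0 : (0 : ℝ) < m := by exact_mod_cast hm1
    rw [div_self hm0.ne', Real.log_one, zero_div, Real.sqrt_mul_self hm0.le]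
    ring
  · have hn1 := (Finset.mem_Icc.mp hn).1
    rw [weightHat_offDiag_eq_zero w B hT hsep hn1 hm1 hmL hnm, mul_zero]

/-- **Diagonal form of the prime sum** for short resonators: when `4πσ(L+1) < T`,
`S = Ŵ_T(0) · Σ_{n ≤ L} Σ_{k ∣ n} Λ(k) g_h(k) r(n/k) r(n)/n` (only `km = n` survives).
[folklore] -/
private theorem primeSum_eq_diag (c : ℝ) (w : Bump) (B : ℕ) (r : ℕ → ℝ) {T : ℝ} {L : ℕ}
    (hT : 0 < T) (hsep : 4 * π * w.σ * ((L : ℝ) + 1) < T) :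
    primeSum c w B r L T = weightHat w B T 0 * ∑ n ∈ Finset.Icc 1 L, ∑ k ∈ n.divisors,
      Λ k * gWeight (gapWidth c T) k * r (n / k) * r n / n := by
  unfold primeSum
  rw [Nat.floor_natCast]
  -- the `k`-sum at fixed `m, n` has at most the single term `k = n / m`
  have hk : ∀ m ∈ Finset.Icc 1 L, ∀ n ∈ Finset.Icc 1 L,
      ∑' k : ℕ, Λ k * gWeight (gapWidth c T) k * r m * r n / Real.sqrt ((k : ℝ) * m * n) *
          weightHat w B T (Real.log ((k : ℝ) * m / n) / (2 * π))
        = if m ∣ n then Λ (n / m) * gWeight (gapWidth c T) (n / m) * r m * r n / n *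
            weightHat w B T 0 else 0 := by
    intro m hm n hn
    have hm1 := (Finset.mem_Icc.mp hm).1
    have hn1 := (Finset.mem_Icc.mp hn).1
    have hnL := (Finset.mem_Icc.mp hn).2
    have hm0 : (0 : ℝ) < m := by exact_mod_cast hm1
    have hn0 : (0 : ℝ) < n := by exact_mod_cast hn1
    have hzero : ∀ k : ℕ, k * m ≠ n →
        Λ k * gWeight (gapWidth c T) k * r m * r n / Real.sqrt ((k : ℝ) * m * n) *
          weightHat w B T (Real.log ((k : ℝ) * m / n) / (2 * π)) = 0 := by
      intro k hkm
      rcases Nat.eq_zero_or_pos k with rfl | hkpos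
      · simp
      · have hp : 1 ≤ k * m := Nat.one_le_iff_ne_zero.mpr (Nat.mul_ne_zero hkpos.ne' (by omega))
        have := weightHat_offDiag_eq_zero w B hT hsep hp hn1 hnL hkm
        push_cast at this
        rw [this, mul_zero]
    split_ifs with hdvd
    · obtain ⟨q, hq⟩ := hdvd
      have hqn : n / m = q := by rw [hq, Nat.mul_div_cancel_left q hm1]
      have hq0 : 0 < q := Nat.pos_of_ne_zero fun h0 => by subst h0; simp at hq; omega
      rw [tsum_eq_single q fun k hk => hzero k fun hkm => hk ?_]
      · have hqm : ((q : ℝ) * m / n) = 1 := by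
          rw [hq]; push_cast; rw [mul_comm (q : ℝ) m]; exact div_self (by positivity)
        have hsq : Real.sqrt ((q : ℝ) * m * n) = n := by
          rw [hq]; push_cast
          rw [show (q : ℝ) * m * (m * q) = (m * q) * (m * q) by ring]
          exact Real.sqrt_mul_self (by positivity)
        rw [hqm, Real.log_one, zero_div, hsq, hqn]
      · rw [hq, mul_comm] at hkm
        exact Nat.eq_of_mul_eq_mul_left hm1 hkm
    · have hz : (fun k : ℕ => Λ k * gWeight (gapWidth c T) k * r m * r n /
          Real.sqrt ((k : ℝ) * m * n) * weightHat w B T (Real.log ((k : ℝ) * m / n) / (2 * π)))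
          = fun _ => 0 := funext fun k => hzero k fun hkm => hdvd ⟨k, by rw [← hkm, mul_comm]⟩
      rw [hz, tsum_zero]
  rw [Finset.sum_congr rfl fun m hm => Finset.sum_congr rfl fun n hn => hk m hm n hn,
    Finset.sum_comm, Finset.mul_sum]
  refine Finset.sum_congr rfl fun n hn => ?_
  have hn1 := (Finset.mem_Icc.mp hn).1
  have hnL := (Finset.mem_Icc.mp hn).2
  rw [← Finset.sum_filter]
  have hfilt : (Finset.Icc 1 L).filter (· ∣ n) = n.divisors := by
    ext m
    simp only [Finset.mem_filter, Finset.mem_Icc, Nat.mem_divisors]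
    constructor
    · rintro ⟨-, hmn⟩; exact ⟨hmn, by omega⟩
    · rintro ⟨hmn, -⟩
      have := Nat.le_of_dvd (by omega) hmn
      exact ⟨⟨Nat.pos_of_dvd_of_pos hmn (by omega), by omega⟩, hmn⟩
  rw [hfilt, Finset.mul_sum]
  -- reindex `m ↦ n / m` on the divisors
  rw [← Nat.sum_div_divisors n (fun k => weightHat w B T 0 *
    (Λ k * gWeight (gapWidth c T) k * r (n / k) * r n / n))]
  refine Finset.sum_congr rfl fun m hm => ?_
  have hmn : m ∣ n := (Nat.mem_divisors.mp hm).1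
  rw [Nat.div_div_self hmn (by omega)]
  ring

/-! ### §3 From a real resonator `b` to admissible BH coefficients `r(n) = λ b(n) √n` -/

/-- The real part of the bilinear form of a REAL sequence, as a real double sum. [folklore] -/
private theorem re_moForm_real (b : ℕ → ℝ) (L : ℕ) (h : ℝ) :
    (InoueKobayashiToma2025.moForm (fun n => (b n : ℂ)) L h).re
      = 2 / π * ∑ n ∈ Finset.Icc 1 L, ∑ k ∈ n.divisors,
          Λ k / (Real.sqrt k * Real.log k) * Real.sin (h / 2 * Real.log k) * b (n / k) * b n := by
  unfold InoueKobayashiToma2025.moForm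
  have h2π : (2 / π : ℂ) = ((2 / π : ℝ) : ℂ) := by push_cast; rfl
  rw [h2π, Complex.re_ofReal_mul, Complex.re_sum]
  congr 1
  refine Finset.sum_congr rfl fun n _ => ?_
  rw [Complex.re_sum]
  refine Finset.sum_congr rfl fun k _ => ?_
  rw [Complex.conj_ofReal, ← Complex.ofReal_mul, ← Complex.ofReal_mul, Complex.ofReal_re]

/-- The norm of a real sequence. [folklore] -/
private theorem coeffNormSq_real (b : ℕ → ℝ) (L : ℕ) :
    coeffNormSq (fun n => (b n : ℂ)) L = ∑ n ∈ Finset.Icc 1 L, b n ^ 2 := by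
  unfold coeffNormSq
  refine Finset.sum_congr rfl fun n _ => ?_
  rw [Complex.norm_real, Real.norm_eq_abs, sq_abs]

/-- **Normalisation.** A real sequence `b` with positive norm on `[1, L]` yields BH-admissible
coefficients `r` (`|r(n)| ≤ n^ε` for all `n ≥ 1`, `Σ_{n ≤ L} r(n)²/n ≥ 1/L`) with
`r(n) = λ b(n) √n` on `[1, L]` for some `λ > 0` and `r = 0` off `[1, L]`. [folklore] -/
private theorem exists_admissible (b : ℕ → ℝ) {L : ℕ} {ε : ℝ} (hε : 0 ≤ ε)
    (hN : 0 < coeffNormSq (fun n => (b n : ℂ)) L) :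
    ∃ lam : ℝ, 0 < lam ∧ ∃ r : ℕ → ℝ,
      (∀ n ∈ Finset.Icc 1 L, r n = lam * b n * Real.sqrt n) ∧
      (∀ n, n ∉ Finset.Icc 1 L → r n = 0) ∧
      (∀ n : ℕ, 1 ≤ n → |r n| ≤ 1 * (n : ℝ) ^ ε) ∧
      1 / (L : ℝ) ≤ ∑ n ∈ Finset.Icc 1 L, r n ^ 2 / n := by
  classical
  have hne : (Finset.Icc 1 L).Nonempty := by
    by_contra hem
    rw [Finset.not_nonempty_iff_eq_empty] at hem
    simp [coeffNormSq, hem] at hN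
  set q : ℕ → ℝ := fun n => |b n| * Real.sqrt n / (n : ℝ) ^ ε with hq
  obtain ⟨n₀, hn₀, hmax⟩ := Finset.exists_max_image (Finset.Icc 1 L) q hne
  have hn₀1 : 1 ≤ n₀ := (Finset.mem_Icc.mp hn₀).1
  have hn₀L : n₀ ≤ L := (Finset.mem_Icc.mp hn₀).2
  have hn₀0 : (0 : ℝ) < n₀ := by exact_mod_cast hn₀1
  set m₀ := q n₀ with hm₀
  -- `m₀ > 0`: otherwise `b` vanishes on `[1, L]`
  have hm₀pos : 0 < m₀ := by
    by_contra hle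
    push Not at hle
    have hz : ∀ n ∈ Finset.Icc 1 L, b n = 0 := by
      intro n hn
      have hn1 : (0 : ℝ) < n := by exact_mod_cast (Finset.mem_Icc.mp hn).1
      have h1 : q n ≤ 0 := (hmax n hn).trans hle
      have h2 : 0 ≤ q n := by simp only [hq]; positivity
      have h3 : q n = 0 := le_antisymm h1 h2
      simp only [hq, div_eq_zero_iff, mul_eq_zero, abs_eq_zero, Real.sqrt_eq_zero', not_le.mpr hn1,
        or_false] at h3
      rcases h3 with h3 | h3
      · exact h3
      · exact absurd h3 (by positivity)
    rw [coeffNormSq_real] at hN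
    have : ∑ n ∈ Finset.Icc 1 L, b n ^ 2 = 0 := Finset.sum_eq_zero fun n hn => by rw [hz n hn]; ring
    linarith
  refine ⟨1 / m₀, by positivity, fun n => if n ∈ Finset.Icc 1 L then 1 / m₀ * b n * Real.sqrt n else 0,
    fun n hn => by simp [hn], fun n hn => by simp [hn], fun n hn1 => ?_, ?_⟩
  · -- the bound `|r n| ≤ n^ε`
    have hn0 : (0 : ℝ) < n := by exact_mod_cast hn1
    dsimp only
    split_ifs with hn
    · have hqn : q n ≤ m₀ := hmax n hn
      simp only [hq] at hqn
      rw [div_le_iff₀ (by positivity)] at hqn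
      rw [abs_mul, abs_mul, abs_of_pos (by positivity : (0 : ℝ) < 1 / m₀),
        abs_of_nonneg (Real.sqrt_nonneg _), one_mul]
      rw [show 1 / m₀ * |b n| * Real.sqrt n = |b n| * Real.sqrt n / m₀ by ring,
        div_le_iff₀ hm₀pos]
      linarith [mul_comm m₀ ((n : ℝ) ^ ε)]
    · simp; positivity
  · -- the lower bound at `n₀`
    have hterm : ∀ n ∈ Finset.Icc 1 L,
        0 ≤ (if n ∈ Finset.Icc 1 L then 1 / m₀ * b n * Real.sqrt n else 0) ^ 2 / (n : ℝ) :=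
      fun n _ => by positivity
    refine le_trans ?_ (Finset.single_le_sum hterm hn₀)
    rw [if_pos hn₀]
    have hsq : Real.sqrt (n₀ : ℝ) ^ 2 = n₀ := Real.sq_sqrt hn₀0.le
    have hval : (1 / m₀ * b n₀ * Real.sqrt n₀) ^ 2 / (n₀ : ℝ) = b n₀ ^ 2 / m₀ ^ 2 := by
      rw [mul_pow, mul_pow, hsq]; field_simp
    rw [hval]
    -- `b n₀² / m₀² = n₀^{2ε}/n₀ ≥ 1/n₀ ≥ 1/L`
    have hm₀eq : m₀ = |b n₀| * Real.sqrt n₀ / (n₀ : ℝ) ^ ε := rfl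
    have hpow : (1 : ℝ) ≤ (n₀ : ℝ) ^ ε := Real.one_le_rpow (by exact_mod_cast hn₀1) hε
    have hm₀sq : m₀ ^ 2 = b n₀ ^ 2 * n₀ / ((n₀ : ℝ) ^ ε) ^ 2 := by
      rw [hm₀eq, div_pow, mul_pow, sq_abs, hsq]
    rw [hm₀sq, div_div_eq_mul_div]
    have hb0 : b n₀ ^ 2 ≠ 0 := by
      intro h0
      rw [hm₀eq, show b n₀ = 0 from pow_eq_zero_iff (n := 2) (by norm_num) |>.mp h0] at hm₀pos
      simp at hm₀pos
    have hb : b n₀ ≠ 0 := fun h0 => hb0 (by rw [h0]; ring)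
    rw [show b n₀ ^ 2 * ((n₀ : ℝ) ^ ε) ^ 2 / (b n₀ ^ 2 * n₀) = ((n₀ : ℝ) ^ ε) ^ 2 / n₀ by
      field_simp]
    have hL0 : (n₀ : ℝ) ≤ L := by exact_mod_cast hn₀L
    calc 1 / (L : ℝ) ≤ 1 / (n₀ : ℝ) := one_div_le_one_div_of_le hn₀0 hL0
      _ ≤ ((n₀ : ℝ) ^ ε) ^ 2 / n₀ := by
          apply div_le_div_of_nonneg_right _ hn₀0.le
          nlinarith

/-- **The bilinear form in BH coordinates.** For `r(n) = λ b(n) √n` on `[1, L]`: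
`Σ_{n ≤ L} Σ_{k ∣ n} Λ(k) g_h(k) r(n/k) r(n)/n = λ² (π/2) · Re moForm(b, L, h)`. [folklore] -/
private theorem diagSum_eq (b r : ℕ → ℝ) {L : ℕ} {lam h : ℝ}
    (hr : ∀ n ∈ Finset.Icc 1 L, r n = lam * b n * Real.sqrt n) :
    ∑ n ∈ Finset.Icc 1 L, ∑ k ∈ n.divisors, Λ k * gWeight h k * r (n / k) * r n / n
      = lam ^ 2 * (π / 2) * (InoueKobayashiToma2025.moForm (fun n => (b n : ℂ)) L h).re := by
  have hπ : (π / 2) * (2 / π) = 1 := by field_simp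
  rw [re_moForm_real, mul_assoc (lam ^ 2) (π / 2), ← mul_assoc (π / 2) (2 / π), hπ, one_mul,
    Finset.mul_sum]
  refine Finset.sum_congr rfl fun n hn => ?_
  have hn1 := (Finset.mem_Icc.mp hn).1
  have hnL := (Finset.mem_Icc.mp hn).2
  have hn0 : (0 : ℝ) < n := by exact_mod_cast hn1
  rw [Finset.mul_sum]
  refine Finset.sum_congr rfl fun k hk => ?_
  have hkn : k ∣ n := (Nat.mem_divisors.mp hk).1
  have hk1 : 1 ≤ k := Nat.pos_of_dvd_of_pos hkn (by omega)
  have hk0 : (0 : ℝ) < k := by exact_mod_cast hk1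
  have hnk : n / k ∈ Finset.Icc 1 L := by
    rw [Finset.mem_Icc]
    exact ⟨(Nat.le_div_iff_mul_le hk1).mpr (by simpa using Nat.le_of_dvd (by omega) hkn),
      (Nat.div_le_self n k).trans hnL⟩
  rw [hr n hn, hr (n / k) hnk, Nat.cast_div hkn hk0.ne']
  rcases eq_or_ne (Real.log k) 0 with hlog | hlog
  · -- `k = 1`: both sides vanish (`Λ 1 = 0`)
    have : k = 1 := by
      rcases Real.log_eq_zero.mp hlog with h | h | h
      · exact absurd h hk0.ne'
      · exact_mod_cast h
      · exact absurd h (by linarith)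
    subst this
    simp
  have hsq : Real.sqrt ((n : ℝ) / k) * Real.sqrt n = n / Real.sqrt k := by
    rw [← Real.sqrt_mul (by positivity), Real.sqrt_eq_iff_mul_self_eq_of_pos (by positivity)]
    field_simp
    rw [Real.sq_sqrt hk0.le]
  unfold gWeight
  rw [show h * Real.log k / 2 = h / 2 * Real.log k by ring]
  have hksqrt : 0 < Real.sqrt k := Real.sqrt_pos.mpr hk0
  calc Λ k * (Real.sin (h / 2 * Real.log k) / Real.log k)
        * (lam * b (n / k) * Real.sqrt ((n : ℝ) / k)) * (lam * b n * Real.sqrt n) / n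
      = Λ k * (Real.sin (h / 2 * Real.log k) / Real.log k) * lam ^ 2 * b (n / k) * b n *
          (Real.sqrt ((n : ℝ) / k) * Real.sqrt n) / n := by ring
    _ = lam ^ 2 * (Λ k / (Real.sqrt k * Real.log k) * Real.sin (h / 2 * Real.log k)
          * b (n / k) * b n) := by
        rw [hsq]; field_simp

/-- `Σ_{n ≤ L} r(n)²/n = λ² · N(b)` for `r(n) = λ b(n) √n`. [folklore] -/
private theorem normSum_eq (b r : ℕ → ℝ) {L : ℕ} {lam : ℝ}
    (hr : ∀ n ∈ Finset.Icc 1 L, r n = lam * b n * Real.sqrt n) :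
    ∑ n ∈ Finset.Icc 1 L, r n ^ 2 / n = lam ^ 2 * coeffNormSq (fun n => (b n : ℂ)) L := by
  rw [coeffNormSq_real, Finset.mul_sum]
  refine Finset.sum_congr rfl fun n hn => ?_
  have hn0 : (0 : ℝ) < n := by exact_mod_cast (Finset.mem_Icc.mp hn).1
  rw [hr n hn, mul_pow, mul_pow, Real.sq_sqrt hn0.le]
  field_simp

/-! ### §4 Threshold bookkeeping -/

/-- From `a^{1/δ} ≤ T` (`a ≥ 0`, `δ > 0`) to `a ≤ T^δ`. [folklore] -/
private theorem le_rpow_of_rpow_inv_le {a δ T : ℝ} (ha : 0 ≤ a) (hδ : 0 < δ)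
    (h : a ^ (1 / δ) ≤ T) : a ≤ T ^ δ := by
  have := Real.rpow_le_rpow (Real.rpow_nonneg ha _) h hδ.le
  rwa [← Real.rpow_mul ha, one_div_mul_cancel hδ.ne', Real.rpow_one] at this

/-- `T^{1−δ} · T^δ = T` for `T > 0`. [folklore] -/
private theorem rpow_one_sub_mul_rpow {T δ : ℝ} (hT : 0 < T) : T ^ (1 - δ) * T ^ δ = T := by
  rw [← Real.rpow_add hT, sub_add_cancel, Real.rpow_one]

end MOC

set_option maxHeartbeats 400000 in
-- one ≈ 200-line assembly of many small steps; the default budget runs out near the end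
open MOC BondarenkoHeap2026 BondarenkoHeap2026.Assembly GoldstonTrudgianTurnageButterbaugh2023 in
/-- **The Montgomery–Odlyzko criterion (1984), small-gap half, MARGIN form — PROVED.**
"Montgomery and Odlyzko proved that if `h(c) > 1` for all sufficiently large `T` for some choice
of `a_k`'s, `c`, and a small `δ`, then assuming RH we have `μ ≤ c`" (as restated by
Goldston–Trudgian–Turnage-Butterbaugh 2023, §1; the method is Montgomery–Odlyzko 1984 and, in the
`M₂/M₁` form, Conrey–Ghosh–Gonek 1984 p. 423). Here `h(c) = c − Re(moForm)/Σ|a_k|²` is the tree's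
`moFunctional` over resonators of length `y = ⌊T^{1−δ}⌋` (`resonatorLength`), the coefficients
may depend on `T`, and the hypothesis is taken with a UNIFORM MARGIN `h(c) ≥ 1 + η` (which is what
the method supports — the implied constants of the method depend on nothing but `c, δ` once the
coefficients are normalised; landau-siegel's as-typed `montgomeryOdlyzko1984_criterion`, with
`1 < h(c)` pointwise in `T`, is NOT discharged by this theorem, finding F-MO-1). ROAD (Bondarenko–
Heap 2026 §2 instead of Montgomery–Odlyzko's sharp count over `[T, 2T]`; for a `lim inf`
statement the choice of a non-negative weight is immaterial): (1) complex coefficients reduce to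
real ones (`Re moForm(u + iv) = Re moForm(u) + Re moForm(v)`, mediant); (2) normalise to BH
coefficients `r(n) = λ b(n)√n` with `|r(n)| ≤ n^ε`, `Σ r²/n ≥ 1/y`; (3) for `y ≤ T^{1−δ}` and `T`
large the support of `Ŵ_T` (BH (2), `weightHat_support_holds`) kills every off-diagonal term, so
`I₀ = Ŵ_T(0)Σ r²/n` and `(2/π)S = Ŵ_T(0)λ² Re moForm(b)`, i.e. `cI₀ − (2/π)S = I₀·h(c) ≥ (1+η)I₀`;
(4) BH Proposition 1 (`proposition1_holds`, RH) gives `I₁ ≥ (1 + η/2)I₀`, the extension lemma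
(`extensionToLine_holds`) transfers this to the window `[T^{1−ε}, T^{1+ε}]`, and the small-gaps
criterion (`smallGaps_criterion`) produces consecutive ordinates at distance `≤ 2πc/log T` near
height `T`, i.e. a normalised gap `≤ c(1 + 2ε)` with index `→ ∞`; (5) `c ≥ 1` is covered by
Selberg–Fujii (`zetaGapLiminfBelow_one`). ENABLER for the μ-records (MO84 0.5179, CGG84 0.5172, …),
which additionally need their coefficient asymptotics. NOT RH-BEARING: RH is the HYPOTHESIS.
[cite: GoldstonTrudgianTurnageButterbaugh2023, §1 p. 2 (the Montgomery–Odlyzko criterion); MontgomeryOdlyzko1984 main theorem] -/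
theorem montgomeryOdlyzko1984_criterion_of_margin :
    RiemannHypothesis → ∀ δ c η : ℝ, 0 < δ → δ < 1 → 0 < c → 0 < η → ∀ a : ℝ → ℕ → ℂ,
      (∃ T₀ : ℝ, ∀ T : ℝ, T₀ ≤ T →
          0 < coeffNormSq (a T) (resonatorLength δ T) ∧
            1 + η ≤ moFunctional c (a T) (resonatorLength δ T) T) →
        ZetaGapLiminfLe c := by
  intro hRH δ c η hδ hδ1 hc hη a hyp c' hcc'
  obtain ⟨Th, hTh⟩ := hyp
  -- the range `c' ≥ 1` is Selberg–Fujii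
  by_cases hc'1 : 1 ≤ c'
  · exact zetaGapLiminfBelow_one.mono hc'1
  push Not at hc'1
  have hc1 : c ≤ 1 := by linarith
  -- choose `ε`
  set ε : ℝ := min (1 / 2) (min (η / 8) ((c' - c) / (4 * c))) with hε_def
  have hε0 : 0 < ε := lt_min (by norm_num) (lt_min (by positivity) (by
    apply div_pos <;> linarith))
  have hε_half : ε ≤ 1 / 2 := min_le_left _ _
  have hε1 : ε < 1 := by linarith
  have hεη : ε ≤ η / 8 := (min_le_right _ _).trans (min_le_left _ _)
  have hεc : c * (1 + 2 * ε) < c' := by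
    have h1 : ε ≤ (c' - c) / (4 * c) := (min_le_right _ _).trans (min_le_right _ _)
    have h2 : c * (2 * ε) ≤ (c' - c) / 2 := by
      calc c * (2 * ε) ≤ c * (2 * ((c' - c) / (4 * c))) := by gcongr
        _ = (c' - c) / 2 := by field_simp; ring
    nlinarith
  -- the bump and the BH constants
  set w : Bump := bumpStar with hw_def
  obtain ⟨B₁, hB₁⟩ := proposition1_holds hRH c ε 1 1 1 hc hc1 hε0 hε1 one_pos one_pos zero_le_one w
  obtain ⟨B₂, hB₂⟩ := extensionToLine_holds c ε 1 1 1 hc hε0 hε1 one_pos one_pos zero_le_one w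
  set B : ℕ := max B₁ B₂ with hB_def
  obtain ⟨K₁, hK₁⟩ := hB₁ B (le_max_left _ _)
  obtain ⟨KE, T₂, hKE⟩ := hB₂ B (le_max_right _ _)
  obtain ⟨T₁, hT₁⟩ := hK₁ (η / 8) (by positivity)
  obtain ⟨K₃, hK₃⟩ := weightHat_zero_holds w B
  have hCΦ : 0 < cPhi w B := cPhi_pos_holds w B
  have hσ : 0 < w.σ := w.σ_pos
  -- the witness `c'' = c(1 + 2ε)`
  refine ⟨c * (1 + 2 * ε), hεc, ?_⟩
  rw [Filter.frequently_atTop]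
  intro N
  -- a large `T`
  have hev : ∀ᶠ T : ℝ in atTop, Th ≤ T ∧ T₁ ≤ T ∧ T₂ ≤ T ∧ 7 ≤ T ∧
      Real.exp (Real.log 2 / ε) ≤ T ∧ (zetaOrdinate N + 4) ^ 2 ≤ T ∧
      (16 * π * w.σ) ^ (1 / δ) ≤ T ∧ 2 * |K₃| / cPhi w B ≤ T ∧ (2 / cPhi w B) ^ (1 / δ) ≤ T ∧
      8 * |K₁| / η ≤ T ∧ 8 * |KE| / η ≤ T := by
    filter_upwards [eventually_ge_atTop Th, eventually_ge_atTop T₁, eventually_ge_atTop T₂,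
      eventually_ge_atTop (7 : ℝ), eventually_ge_atTop (Real.exp (Real.log 2 / ε)),
      eventually_ge_atTop ((zetaOrdinate N + 4) ^ 2),
      eventually_ge_atTop ((16 * π * w.σ) ^ (1 / δ)), eventually_ge_atTop (2 * |K₃| / cPhi w B),
      eventually_ge_atTop ((2 / cPhi w B) ^ (1 / δ)), eventually_ge_atTop (8 * |K₁| / η),
      eventually_ge_atTop (8 * |KE| / η)] with T h1 h2 h3 h4 h5 h6 h7 h8 h9 h10 h11
    exact ⟨h1, h2, h3, h4, h5, h6, h7, h8, h9, h10, h11⟩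
  obtain ⟨T, hTh', hT₁', hT₂', hT7, hTexp, hγN, hTsep, hTK₃, hTCΦ, hTK₁, hTKE⟩ := hev.exists
  have hT0 : 0 < T := by linarith
  have hT1 : 1 < T := by linarith
  have hlogT : 0 < Real.log T := Real.log_pos hT1
  have hlog2 : Real.log 2 / ε ≤ Real.log T := by
    have := Real.log_le_log (Real.exp_pos _) hTexp
    rwa [Real.log_exp] at this
  -- powers of `T`
  have hTδ : 16 * π * w.σ ≤ T ^ δ := le_rpow_of_rpow_inv_le (by positivity) hδ hTsep
  have hTδ' : 2 / cPhi w B ≤ T ^ δ := le_rpow_of_rpow_inv_le (by positivity) hδ hTCΦ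
  have hsplit := rpow_one_sub_mul_rpow (δ := δ) hT0
  have hpow0 : 0 < T ^ (1 - δ) := Real.rpow_pos_of_pos hT0 _
  have hpowδ0 : 0 < T ^ δ := Real.rpow_pos_of_pos hT0 _
  have hpow_le_T : T ^ (1 - δ) ≤ T := by
    calc T ^ (1 - δ) ≤ T ^ (1 : ℝ) := Real.rpow_le_rpow_of_exponent_le hT1.le (by linarith)
      _ = T := Real.rpow_one T
  -- the resonator at this `T`
  obtain ⟨hNpos, hmarg⟩ := hTh T hTh'
  unfold moFunctional at hmarg
  -- (1) a real resonator with the margin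
  obtain ⟨b, hNb, hmb⟩ := exists_real_of_margin (h := 2 * π * c / Real.log T) hNpos hmarg
  set L : ℕ := resonatorLength δ T with hL_def
  have hL_eq : L = ⌊T ^ (1 - δ)⌋₊ := rfl
  have hLle : (L : ℝ) ≤ T ^ (1 - δ) := by rw [hL_eq]; exact Nat.floor_le hpow0.le
  have hL1 : 1 ≤ L := by
    by_contra h0
    push Not at h0
    have hL0 : L = 0 := by omega
    rw [hL0] at hNb
    simp [coeffNormSq] at hNb
  have hL1r : (1 : ℝ) ≤ L := by exact_mod_cast hL1
  -- (2) admissible BH coefficients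
  obtain ⟨lam, hlam, r, hr_on, hr_off, hr_bd, hr_low⟩ := exists_admissible b hε0.le hNb
  -- (3) separation and the diagonal forms
  have hsep : 4 * π * w.σ * ((L : ℝ) + 1) < T := by
    have h1 : (L : ℝ) + 1 ≤ 2 * T ^ (1 - δ) := by
      have : (1 : ℝ) ≤ T ^ (1 - δ) := by
        calc (1 : ℝ) = T ^ (0 : ℝ) := (Real.rpow_zero T).symm
          _ ≤ T ^ (1 - δ) := Real.rpow_le_rpow_of_exponent_le hT1.le (by linarith)
      linarith
    calc 4 * π * w.σ * ((L : ℝ) + 1) ≤ 4 * π * w.σ * (2 * T ^ (1 - δ)) := by gcongr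
      _ = 8 * π * w.σ * T ^ (1 - δ) := by ring
      _ < T ^ δ * T ^ (1 - δ) := by
          apply mul_lt_mul_of_pos_right _ hpow0
          nlinarith [Real.pi_pos]
      _ = T := by rw [mul_comm, hsplit]
  have hW0 : cPhi w B * T / 2 ≤ weightHat w B T 0 := by
    have h1 := hK₃ T hT1.le
    have h2 : K₃ * T⁻¹ ≤ |K₃| := by
      have h3 : K₃ * T⁻¹ ≤ |K₃| * T⁻¹ :=
        mul_le_mul_of_nonneg_right (le_abs_self _) (by positivity)
      have h4 : |K₃| * T⁻¹ ≤ |K₃| * 1 :=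
        mul_le_mul_of_nonneg_left (inv_le_one_of_one_le₀ hT1.le) (abs_nonneg _)
      linarith
    have h3 : |K₃| ≤ cPhi w B * T / 2 := by
      have := (div_le_iff₀ hCΦ).mp hTK₃
      nlinarith
    have h4 := (abs_le.mp h1).1
    linarith
  have hW0pos : 0 < weightHat w B T 0 := lt_of_lt_of_le (by positivity) hW0
  have hI0R_eq := I0R_eq_diag w B r hT0 hsep
  have hS_eq := primeSum_eq_diag c w B r hT0 hsep
  simp only [gapWidth] at hS_eq
  have hnorm := normSum_eq b r hr_on
  have hdiag := diagSum_eq b r (h := 2 * π * c / Real.log T) hr_on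
  -- `I₀ ≥ 1`
  have hLr_le : (L : ℝ) ≤ cPhi w B * T / 2 := by
    have h1 : T ^ (1 - δ) * (2 / cPhi w B) ≤ T ^ (1 - δ) * T ^ δ :=
      mul_le_mul_of_nonneg_left hTδ' hpow0.le
    rw [hsplit, ← mul_div_assoc, div_le_iff₀ hCΦ] at h1
    linarith
  have hL0r : (0 : ℝ) < L := by linarith
  have hI0R_ge : 1 ≤ I0R w B r L T := by
    rw [hI0R_eq]
    have h1 : 1 / (cPhi w B * T / 2) ≤ 1 / (L : ℝ) := one_div_le_one_div_of_le hL0r hLr_le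
    calc (1 : ℝ) = (cPhi w B * T / 2) * (1 / (cPhi w B * T / 2)) := by field_simp
      _ ≤ weightHat w B T 0 * ∑ n ∈ Finset.Icc 1 L, r n ^ 2 / n :=
          mul_le_mul hW0 (h1.trans hr_low) (by positivity) hW0pos.le
  have hI0R_pos : 0 < I0R w B r L T := by linarith
  -- the key inequality `c I₀ − (2/π) S ≥ (1 + η) I₀`
  obtain ⟨M, hM⟩ : ∃ M : ℝ,
      M = (InoueKobayashiToma2025.moForm (fun n => (b n : ℂ)) L (2 * π * c / Real.log T)).re :=
    ⟨_, rfl⟩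
  obtain ⟨Nb, hNb_eq⟩ : ∃ Nb : ℝ, Nb = coeffNormSq (fun n => (b n : ℂ)) L := ⟨_, rfl⟩
  obtain ⟨W0, hW0_eq⟩ : ∃ W0 : ℝ, W0 = weightHat w B T 0 := ⟨_, rfl⟩
  rw [← hM, ← hNb_eq] at hmb
  rw [← hNb_eq] at hNb hnorm
  rw [← hM] at hdiag
  rw [← hW0_eq] at hW0 hW0pos hI0R_eq hS_eq
  have hMN : (1 + η) * Nb ≤ c * Nb - M := by
    have h1 : M / Nb ≤ c - (1 + η) := by linarith
    rw [div_le_iff₀ hNb] at h1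
    linarith
  have hkey : (1 + η) * I0R w B r L T ≤ c * I0R w B r L T - 2 / π * primeSum c w B r L T := by
    rw [hI0R_eq, hS_eq, hnorm, hdiag]
    have hpos : 0 ≤ W0 * lam ^ 2 := by positivity
    have h2 : 2 / π * (W0 * (lam ^ 2 * (π / 2) * M)) = W0 * lam ^ 2 * M := by
      field_simp
    rw [h2]
    have h3 := mul_le_mul_of_nonneg_left hMN hpos
    have h4 : W0 * lam ^ 2 * ((1 + η) * Nb) = (1 + η) * (W0 * (lam ^ 2 * Nb)) := by ring
    have h5 : W0 * lam ^ 2 * (c * Nb - M) = c * (W0 * (lam ^ 2 * Nb)) - W0 * lam ^ 2 * M := by ring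
    linarith
  -- (4) Proposition 1 at this `T`
  have hLT : (L : ℝ) ≤ T ^ (1 : ℝ) := by rw [Real.rpow_one]; exact hLle.trans hpow_le_T
  have hP1 := hT₁ T hT₁' (L : ℝ) hL1r hLT r hr_bd
  have hTinv : T ^ (-(1 : ℝ)) = T⁻¹ := Real.rpow_neg_one T
  have hinv_bound : ∀ K : ℝ, 8 * |K| / η ≤ T → K * T ^ (-(1 : ℝ)) ≤ η / 8 := by
    intro K hK
    rw [hTinv]
    have h1 : K * T⁻¹ ≤ |K| * T⁻¹ := mul_le_mul_of_nonneg_right (le_abs_self _) (by positivity)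
    have h2 : |K| * T⁻¹ ≤ η / 8 := by
      rw [← div_eq_mul_inv, div_le_iff₀ hT0]
      have := (div_le_iff₀ hη).mp hK
      linarith
    linarith
  have hK₁T := hinv_bound K₁ hTK₁
  have hI1R : (1 + η / 2) * I0R w B r L T ≤ I1R c w B r L T := by
    have h := (abs_le.mp hP1).1
    have hεI : ε * I0R w B r L T ≤ η / 8 * I0R w B r L T :=
      mul_le_mul_of_nonneg_right hεη hI0R_pos.le
    have hηI : η / 8 ≤ η / 8 * I0R w B r L T := le_mul_of_one_le_right (by positivity) hI0R_ge
    linarith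
  -- (5) extension to the window
  obtain ⟨hI0pos, hExt⟩ := hKE T hT₂' (L : ℝ) hL1r hLT r hr_bd hI0R_ge
  have hKET := hinv_bound KE hTKE
  have hratioR : 1 + η / 2 ≤ I1R c w B r L T / I0R w B r L T := by
    rw [le_div_iff₀ hI0R_pos]; exact hI1R
  have hratio : 1 < I1 c ε w B r L T / I0 ε w B r L T := by
    have := (abs_le.mp hExt).1
    linarith
  have hI : I0 ε w B r L T < I1 c ε w B r L T := (one_lt_div hI0pos).mp hratio
  -- (6) the small-gaps criterion and the index bookkeeping
  obtain ⟨m, hγlow, -, -, hδm⟩ := smallGaps_criterion hc.le hT1 hI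
  have hgap := gapBound_le hc.le hc1 hε0 hT7 hlog2
  have hh4 := gapWidth_half_le_four hc.le hc1 hT7
  have hδ' : zetaNormalizedGap m ≤ c * (1 + 2 * ε) := hδm.trans hgap
  have hTε : Real.sqrt T ≤ T ^ (1 - ε) := by
    rw [Real.sqrt_eq_rpow]
    exact Real.rpow_le_rpow_of_exponent_le hT1.le (by linarith)
  have hγNm : zetaOrdinate N < zetaOrdinate m := by
    have h1 : zetaOrdinate N + 4 ≤ Real.sqrt T := Real.le_sqrt_of_sq_le hγN
    linarith
  refine ⟨m, ?_, hδ'⟩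
  by_contra hmN
  exact absurd (zetaOrdinate_mono_holds (not_le.mp hmN).le) (not_le.mpr hγNm)

/-! ## The LARGE-gap half on the same road (landau-siegel seat ls-lit-r2 g7)

`montgomeryOdlyzko1984_criterion_largeGaps_of_margin'` — «`h(c) < 1 ⇒ λ ≥ c`» [ConreyGhoshGonek1984,
p. 421: "if `h(c) < 1` for some choice of `c`, `a_k` and `δ > 0`, then `λ ≥ c`"] for EVERY
`0 < δ < 1` (the sibling `montgomeryOdlyzko1984_criterion_largeGaps_of_margin` of
`MontgomeryOdlyzkoCriterionProofs.lean`, Landau road, needs `δ > 1/2`; its `-- TODO(general form)`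
is discharged here by a different road). Same steps (1)–(3) as the small-gap half with the
inequalities reversed (`c I₀ − (2/π)S = I₀·h(c) ≤ (1 − η) I₀`); (4) BH Proposition 1 for window
constants `c ≥ 1` (`proposition1_of_one_le`, error `cε I₀`) gives `I₁ ≤ (1 − η/2) I₀`, the
extension lemma moves this to the window, so `𝓘₁ < 𝓘₀`; (5) but if `δ_n < θ' < c` for all
`n ≥ N` then every `t ∈ [T^{1−ε}, T^{1+ε}]` has an ordinate within `h/2 = πc/log T`
(`MOC.one_le_windowCount_of_gaps`, dictionary `Montgomery.zetaOrdinate_le_iff_lt`), so `N_h ≥ 1`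
there and `𝓘₁ ≥ 𝓘₀` — contradiction; (6) `c' < 1` is Selberg–Fujii (`zetaGapLimsupAbove_one`).
Theorems only: 0 `def`, 0 named facts. NOT RH-BEARING: RH is the HYPOTHESIS. -/

namespace MOC

open BondarenkoHeap2026 GoldstonTrudgianTurnageButterbaugh2023

/-- The mediant step, large-gap direction: if `c − Re moForm(f)/N(f) ≤ 1 − η` with `N(f) > 0`,
then the same holds for the real part or for the imaginary part of `f`. [folklore] -/
private theorem exists_real_of_margin_le {f : ℕ → ℂ} {L : ℕ} {h c η : ℝ}
    (hN : 0 < coeffNormSq f L)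
    (hm : c - (InoueKobayashiToma2025.moForm f L h).re / coeffNormSq f L ≤ 1 - η) :
    ∃ b : ℕ → ℝ, 0 < coeffNormSq (fun n => (b n : ℂ)) L ∧
      c - (InoueKobayashiToma2025.moForm (fun n => (b n : ℂ)) L h).re
        / coeffNormSq (fun n => (b n : ℂ)) L ≤ 1 - η := by
  set u : ℕ → ℝ := fun n => (f n).re
  set v : ℕ → ℝ := fun n => (f n).im
  set Mu := (InoueKobayashiToma2025.moForm (fun n => (u n : ℂ)) L h).re with hMu
  set Mv := (InoueKobayashiToma2025.moForm (fun n => (v n : ℂ)) L h).re with hMv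
  set Nu := coeffNormSq (fun n => (u n : ℂ)) L with hNu
  set Nv := coeffNormSq (fun n => (v n : ℂ)) L with hNv
  have hM : (InoueKobayashiToma2025.moForm f L h).re = Mu + Mv := re_moForm_eq_add f L h
  have hNN : coeffNormSq f L = Nu + Nv := coeffNormSq_eq_add f L
  have hNu0 : 0 ≤ Nu := coeffNormSq_nonneg _ _
  have hNv0 : 0 ≤ Nv := coeffNormSq_nonneg _ _
  set κ := c - 1 + η with hκ
  -- clear denominators in the hypothesis: `κ N ≤ M`
  have hm' : κ * (Nu + Nv) ≤ Mu + Mv := by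
    rw [hM, hNN] at hm
    rw [hNN] at hN
    have h2 : c - (1 - η) ≤ (Mu + Mv) / (Nu + Nv) := by linarith
    rw [le_div_iff₀ hN] at h2
    rw [hκ]; linarith
  -- the conclusion from `κ N ≤ M`, `N > 0`
  have concl : ∀ {b : ℕ → ℝ}, 0 < coeffNormSq (fun n => (b n : ℂ)) L →
      κ * coeffNormSq (fun n => (b n : ℂ)) L
        ≤ (InoueKobayashiToma2025.moForm (fun n => (b n : ℂ)) L h).re →
      c - (InoueKobayashiToma2025.moForm (fun n => (b n : ℂ)) L h).re
        / coeffNormSq (fun n => (b n : ℂ)) L ≤ 1 - η := by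
    intro b hb hk
    have : c - (1 - η) ≤ (InoueKobayashiToma2025.moForm (fun n => (b n : ℂ)) L h).re
        / coeffNormSq (fun n => (b n : ℂ)) L := by
      rw [le_div_iff₀ hb, hκ] at *; linarith
    linarith
  rcases hNu0.eq_or_lt with hNu_zero | hNu_pos
  · have hMu0 : Mu = 0 := by
      rw [hMu, moForm_eq_zero_of_coeffNormSq_eq_zero h hNu_zero.symm, Complex.zero_re]
    have hNv_pos : 0 < Nv := by rw [hNN] at hN; linarith
    refine ⟨v, hNv_pos, concl hNv_pos ?_⟩
    rw [← hNu_zero, hMu0] at hm'; simpa using hm'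
  rcases hNv0.eq_or_lt with hNv_zero | hNv_pos
  · have hMv0 : Mv = 0 := by
      rw [hMv, moForm_eq_zero_of_coeffNormSq_eq_zero h hNv_zero.symm, Complex.zero_re]
    refine ⟨u, hNu_pos, concl hNu_pos ?_⟩
    rw [← hNv_zero, hMv0] at hm'; simpa using hm'
  by_cases hu : κ * Nu ≤ Mu
  · exact ⟨u, hNu_pos, concl hNu_pos hu⟩
  · refine ⟨v, hNv_pos, concl hNv_pos ?_⟩
    push Not at hu
    show κ * Nv ≤ Mv
    linarith

/-- **Close ordinates fill the windows.** If `γ_N ≤ t − h/2` and every consecutive pair of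
ordinates `γ_n ≤ t − h/2 < γ_{n+1}` with `n ≥ N` is closer than `h`, then some ordinate lies in
`(t − h/2, t + h/2]`, i.e. `N_h(t) ≥ 1` (dictionary `γ_n ≤ t ↔ n < N(t)`,
`Montgomery.zetaOrdinate_le_iff_lt`, applied at `n = N(t − h/2) − 1`). [folklore] -/
private theorem one_le_windowCount_of_gaps {h t : ℝ} {N : ℕ} (hγN : zetaOrdinate N ≤ t - h / 2)
    (hgap : ∀ n : ℕ, N ≤ n → zetaOrdinate n ≤ t - h / 2 → t - h / 2 < zetaOrdinate (n + 1) →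
      zetaOrdinate (n + 1) - zetaOrdinate n < h) :
    1 ≤ windowCount h t := by
  set m : ℕ := zetaZeroCount (t - h / 2) with hm
  have hNm : N < m := Montgomery.zetaOrdinate_le_iff_lt.mp hγN
  have hm1 : 1 ≤ m := by omega
  have hk : m - 1 + 1 = m := Nat.sub_add_cancel hm1
  -- `γ_{m-1} ≤ t − h/2 < γ_m`
  have hlow : zetaOrdinate (m - 1) ≤ t - h / 2 :=
    Montgomery.zetaOrdinate_le_iff_lt.mpr (by omega)
  have hup : t - h / 2 < zetaOrdinate (m - 1 + 1) := by
    rw [hk]; exact Montgomery.lt_zetaOrdinate_iff.mpr le_rfl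
  have hg := hgap (m - 1) (by omega) hlow hup
  rw [hk] at hg
  have hγm : zetaOrdinate m ≤ t + h / 2 := by linarith
  have hcount : m < zetaZeroCount (t + h / 2) := Montgomery.zetaOrdinate_le_iff_lt.mp hγm
  unfold windowCount
  have : (m : ℝ) + 1 ≤ zetaZeroCount (t + h / 2) := by exact_mod_cast hcount
  rw [hm] at this
  linarith

/-- If `N_h ≥ 1` on the window `[T^{1−ε}, T^{1+ε}]` (`0 ≤ h ≤ 2`, `T > 0`) then `𝓘₀ ≤ 𝓘₁`.
[folklore] -/
private theorem I0_le_I1_of_one_le_windowCount {c ε : ℝ} {w : Bump} {B : ℕ} {r : ℕ → ℝ} {L T : ℝ}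
    (hT : 0 < T) (hh0 : 0 ≤ gapWidth c T) (hh2 : gapWidth c T ≤ 2)
    (h1 : ∀ t ∈ Set.Icc (T ^ (1 - ε)) (T ^ (1 + ε)), 1 ≤ windowCount (gapWidth c T) t) :
    I0 ε w B r L T ≤ I1 c ε w B r L T := by
  unfold I0 I1
  set g : ℝ → ℝ := fun t ↦ ‖BondarenkoHeap2026.dirichletPoly r L t‖ ^ 2 *
    BondarenkoHeap2026.weight w B T t with hg
  have hg_cont : Continuous g :=
    ((continuous_norm.comp (BondarenkoHeap2026.continuous_dirichletPoly r L)).pow 2).mul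
      (continuous_weight w B T)
  have hg_nn : ∀ t, 0 ≤ g t := fun t ↦ mul_nonneg (sq_nonneg _) (weight_nonneg w B T t)
  have hNg : Integrable fun t : ℝ ↦ windowCount (gapWidth c T) t * g t :=
    Prop1.ExplicitSides.integrable_windowCount_mul c w B r L hT hh0 hh2
  refine setIntegral_mono_on hg_cont.integrableOn_Icc hNg.integrableOn measurableSet_Icc ?_
  intro t ht
  have := h1 t ht
  have h2 := hg_nn t
  show g t ≤ windowCount (gapWidth c T) t * g t
  nlinarith

end MOC

set_option maxHeartbeats 800000 in
-- one ≈ 260-line assembly of many small steps (the small-gap half needed 400000 for ≈ 200)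
open MOC BondarenkoHeap2026 BondarenkoHeap2026.Assembly GoldstonTrudgianTurnageButterbaugh2023 in
/-- **The Montgomery–Odlyzko criterion (1984), LARGE-gap half, MARGIN form, for every
`0 < δ < 1` — PROVED.** "By (20) and (21) of [1], if `h(c) < 1` for some choice of `c`, `a_k` and
`δ > 0`, then `λ ≥ c`" (Conrey–Ghosh–Gonek 1984, p. 421, on Montgomery–Odlyzko 1984), with
`h(c) = c − Re(moForm)/Σ|a_k|²` the tree's `moFunctional` over resonators of length
`y = ⌊T^{1−δ}⌋` (`resonatorLength`), coefficients allowed to depend on `T`, hypothesis with a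
UNIFORM MARGIN `h(c) ≤ 1 − η`, conclusion in the non-strict form `∀ c' < c, ZetaGapLimsupAbove c'`
(= `λ ≥ c`; exactly the shape of the `δ > 1/2` sibling
`montgomeryOdlyzko1984_criterion_largeGaps_of_margin`, whose `-- TODO(general form): 0 < δ ≤ 1/2`
this theorem covers by a different road). ROAD (Bondarenko–Heap 2026 §2): (1) complex
coefficients reduce to real ones (mediant, `MOC.exists_real_of_margin_le`); (2) BH-admissible
normalisation `r(n) = λ b(n)√n` (`MOC.exists_admissible`); (3) for `y ≤ T^{1−δ}` the support of
`Ŵ_T` kills every off-diagonal term (`MOC.I0R_eq_diag`, `MOC.primeSum_eq_diag`), so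
`c I₀ − (2/π)S = I₀·h(c) ≤ (1 − η) I₀`; (4) WLOG `c > c' ≥ 1` (else Selberg–Fujii
`zetaGapLimsupAbove_one`), and BH Proposition 1 for window constants `c ≥ 1`
(`proposition1_of_one_le`, RH, error `cε I₀`, `ε ≤ η/(8c)`) gives `I₁ ≤ (1 − η/2) I₀`; the
extension lemma (`extensionToLine_holds`) yields `𝓘₁ < 𝓘₀` on the window `[T^{1−ε}, T^{1+ε}]`;
(5) if `λ ≤ c'`, i.e. `δ_n < θ' := (c + c')/2` for all `n ≥ N`, then for `T` large every
`t ∈ [T^{1−ε}, T^{1+ε}]` has consecutive ordinates `γ_n ≤ t − h/2 < γ_{n+1}` with `n ≥ N` and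
`γ_n ≥ T^{1−ε} − 1/2 − πc ≥ T^{θ'/c}`, so `γ_{n+1} − γ_n < 2πθ'/log γ_n ≤ 2πc/log T = h` and
`N_h(t) ≥ 1` (`MOC.one_le_windowCount_of_gaps`); hence `𝓘₁ ≥ 𝓘₀`
(`MOC.I0_le_I1_of_one_le_windowCount`) — contradiction. ENABLER for the λ-records (MO84
`1.9799`, …), which additionally need their coefficient asymptotics. NOT RH-BEARING: RH is the
HYPOTHESIS.
[cite: ConreyGhoshGonek1984, p. 421 ("if h(c) < 1 for some choice of c, a_k and δ > 0, then λ ≥ c")]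
[cite: MontgomeryOdlyzko1984, main theorem (as quoted by Feng–Wu 2012 §1: "if h(c) < 1 for some choice of c and {a_n}, then λ ≥ c")] -/
theorem montgomeryOdlyzko1984_criterion_largeGaps_of_margin' :
    RiemannHypothesis → ∀ δ c η : ℝ, 0 < δ → δ < 1 → 0 < c → 0 < η → ∀ a : ℝ → ℕ → ℂ,
      (∃ T₀ : ℝ, ∀ T : ℝ, T₀ ≤ T →
          0 < coeffNormSq (a T) (resonatorLength δ T) ∧
            moFunctional c (a T) (resonatorLength δ T) T ≤ 1 - η) →
        ∀ c' : ℝ, c' < c → ZetaGapLimsupAbove c' := by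
  intro hRH δ c η hδ hδ1 hc hη a hyp c' hc'c
  obtain ⟨Th, hTh⟩ := hyp
  -- the range `c' < 1` is Selberg–Fujii
  by_cases hc'1 : c' < 1
  · exact zetaGapLimsupAbove_one.anti hc'1.le
  push Not at hc'1
  have hc1 : 1 ≤ c := by linarith
  -- suppose `λ ≤ c'`: all gaps are eventually `< θ' = (c + c')/2`
  by_contra hnot
  set θ' : ℝ := (c + c') / 2 with hθ'_def
  have hθ'c : θ' < c := by rw [hθ'_def]; linarith
  have hθ'0 : 0 < θ' := by rw [hθ'_def]; linarith
  have hev_gap : ∀ᶠ n in atTop, zetaNormalizedGap n < θ' := by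
    have hnf : ¬ ∃ᶠ n in atTop, θ' ≤ zetaNormalizedGap n :=
      fun hf ↦ hnot ⟨θ', by rw [hθ'_def]; linarith, hf⟩
    simpa [Filter.not_frequently, not_le] using hnf
  obtain ⟨N, hN⟩ := Filter.eventually_atTop.1 hev_gap
  -- choose `ε`
  set ε : ℝ := min (1 / 4) (min (η / (8 * c)) ((c - θ') / (4 * c))) with hε_def
  have hε0 : 0 < ε := lt_min (by norm_num) (lt_min (by positivity) (by
    apply div_pos <;> linarith))
  have hε4 : ε ≤ 1 / 4 := min_le_left _ _
  have hε1 : ε < 1 := by linarith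
  have hεη : c * ε ≤ η / 8 := by
    have h1 : ε ≤ η / (8 * c) := (min_le_right _ _).trans (min_le_left _ _)
    calc c * ε ≤ c * (η / (8 * c)) := by gcongr
      _ = η / 8 := by field_simp
  have hεθ : ε ≤ (c - θ') / (4 * c) := (min_le_right _ _).trans (min_le_right _ _)
  -- the exponent gap `κ = 1 − ε − θ'/c ≥ 3(c − θ')/(4c) > 0`
  set κ : ℝ := 1 - ε - θ' / c with hκ_def
  have hκ0 : 0 < κ := by
    have h1 : θ' / c = 1 - (c - θ') / c := by field_simp; ring
    have h2 : (c - θ') / (4 * c) < (c - θ') / c := by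
      rw [div_lt_div_iff₀ (by positivity) hc]
      nlinarith [mul_pos (sub_pos.mpr hθ'c) hc]
    rw [hκ_def, h1]; linarith
  -- the bump and the BH constants
  set w : Bump := bumpStar with hw_def
  obtain ⟨B₁, hB₁⟩ := proposition1_of_one_le hRH c ε 1 1 1 hc1 hε0 hε1 one_pos one_pos
    zero_le_one w
  obtain ⟨B₂, hB₂⟩ := extensionToLine_holds c ε 1 1 1 hc hε0 hε1 one_pos one_pos zero_le_one w
  set B : ℕ := max B₁ B₂ with hB_def
  obtain ⟨K₁, hK₁⟩ := hB₁ B (le_max_left _ _)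
  obtain ⟨KE, T₂, hKE⟩ := hB₂ B (le_max_right _ _)
  obtain ⟨T₁, hT₁⟩ := hK₁ (η / 8) (by positivity)
  obtain ⟨K₃, hK₃⟩ := weightHat_zero_holds w B
  have hCΦ : 0 < cPhi w B := cPhi_pos_holds w B
  have hσ : 0 < w.σ := w.σ_pos
  -- a large `T`
  have hev : ∀ᶠ T : ℝ in atTop, Th ≤ T ∧ T₁ ≤ T ∧ T₂ ≤ T ∧ 7 ≤ T ∧
      Real.exp (2 * π * c) ≤ T ∧ (zetaOrdinate N + 1) ^ 2 ≤ T ∧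
      (16 * π * w.σ) ^ (1 / δ) ≤ T ∧ 2 * |K₃| / cPhi w B ≤ T ∧ (2 / cPhi w B) ^ (1 / δ) ≤ T ∧
      8 * |K₁| / η ≤ T ∧ 8 * |KE| / η ≤ T ∧ (3 / 2 + π * c) ^ (1 / κ) ≤ T := by
    filter_upwards [eventually_ge_atTop Th, eventually_ge_atTop T₁, eventually_ge_atTop T₂,
      eventually_ge_atTop (7 : ℝ), eventually_ge_atTop (Real.exp (2 * π * c)),
      eventually_ge_atTop ((zetaOrdinate N + 1) ^ 2),
      eventually_ge_atTop ((16 * π * w.σ) ^ (1 / δ)), eventually_ge_atTop (2 * |K₃| / cPhi w B),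
      eventually_ge_atTop ((2 / cPhi w B) ^ (1 / δ)), eventually_ge_atTop (8 * |K₁| / η),
      eventually_ge_atTop (8 * |KE| / η), eventually_ge_atTop ((3 / 2 + π * c) ^ (1 / κ))]
      with T h1 h2 h3 h4 h5 h6 h7 h8 h9 h10 h11 h12
    exact ⟨h1, h2, h3, h4, h5, h6, h7, h8, h9, h10, h11, h12⟩
  obtain ⟨T, hTh', hT₁', hT₂', hT7, hTexp, hγN, hTsep, hTK₃, hTCΦ, hTK₁, hTKE, hTκ⟩ := hev.exists
  have hT0 : 0 < T := by linarith
  have hT1 : 1 < T := by linarith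
  have hlogT : 0 < Real.log T := Real.log_pos hT1
  have hlogTc : 2 * π * c ≤ Real.log T := by
    rw [Real.le_log_iff_exp_le hT0]; exact hTexp
  -- `h = 2πc/log T ∈ (0, 1]`
  have hh0 : 0 < gapWidth c T := by unfold gapWidth; positivity
  have hh1 : gapWidth c T ≤ 1 := by
    unfold gapWidth; rw [div_le_one hlogT]; exact hlogTc
  -- powers of `T`
  have hTδ : 16 * π * w.σ ≤ T ^ δ := le_rpow_of_rpow_inv_le (by positivity) hδ hTsep
  have hTδ' : 2 / cPhi w B ≤ T ^ δ := le_rpow_of_rpow_inv_le (by positivity) hδ hTCΦ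
  have hTκ' : 3 / 2 + π * c ≤ T ^ κ := le_rpow_of_rpow_inv_le (by positivity) hκ0 hTκ
  have hsplit := rpow_one_sub_mul_rpow (δ := δ) hT0
  have hpow0 : 0 < T ^ (1 - δ) := Real.rpow_pos_of_pos hT0 _
  have hpowδ0 : 0 < T ^ δ := Real.rpow_pos_of_pos hT0 _
  have hpow_le_T : T ^ (1 - δ) ≤ T := by
    calc T ^ (1 - δ) ≤ T ^ (1 : ℝ) := Real.rpow_le_rpow_of_exponent_le hT1.le (by linarith)
      _ = T := Real.rpow_one T
  -- the resonator at this `T`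
  obtain ⟨hNpos, hmarg⟩ := hTh T hTh'
  unfold moFunctional at hmarg
  -- (1) a real resonator with the margin
  obtain ⟨b, hNb, hmb⟩ := exists_real_of_margin_le (h := 2 * π * c / Real.log T) hNpos hmarg
  set L : ℕ := resonatorLength δ T with hL_def
  have hL_eq : L = ⌊T ^ (1 - δ)⌋₊ := rfl
  have hLle : (L : ℝ) ≤ T ^ (1 - δ) := by rw [hL_eq]; exact Nat.floor_le hpow0.le
  have hL1 : 1 ≤ L := by
    by_contra h0
    push Not at h0
    have hL0 : L = 0 := by omega
    rw [hL0] at hNb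
    simp [coeffNormSq] at hNb
  have hL1r : (1 : ℝ) ≤ L := by exact_mod_cast hL1
  -- (2) admissible BH coefficients
  obtain ⟨lam, hlam, r, hr_on, hr_off, hr_bd, hr_low⟩ := exists_admissible b hε0.le hNb
  -- (3) separation and the diagonal forms
  have hsep : 4 * π * w.σ * ((L : ℝ) + 1) < T := by
    have h1 : (L : ℝ) + 1 ≤ 2 * T ^ (1 - δ) := by
      have : (1 : ℝ) ≤ T ^ (1 - δ) := by
        calc (1 : ℝ) = T ^ (0 : ℝ) := (Real.rpow_zero T).symm
          _ ≤ T ^ (1 - δ) := Real.rpow_le_rpow_of_exponent_le hT1.le (by linarith)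
      linarith
    calc 4 * π * w.σ * ((L : ℝ) + 1) ≤ 4 * π * w.σ * (2 * T ^ (1 - δ)) := by gcongr
      _ = 8 * π * w.σ * T ^ (1 - δ) := by ring
      _ < T ^ δ * T ^ (1 - δ) := by
          apply mul_lt_mul_of_pos_right _ hpow0
          nlinarith [Real.pi_pos]
      _ = T := by rw [mul_comm, hsplit]
  have hW0 : cPhi w B * T / 2 ≤ weightHat w B T 0 := by
    have h1 := hK₃ T hT1.le
    have h2 : K₃ * T⁻¹ ≤ |K₃| := by
      have h3 : K₃ * T⁻¹ ≤ |K₃| * T⁻¹ :=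
        mul_le_mul_of_nonneg_right (le_abs_self _) (by positivity)
      have h4 : |K₃| * T⁻¹ ≤ |K₃| * 1 :=
        mul_le_mul_of_nonneg_left (inv_le_one_of_one_le₀ hT1.le) (abs_nonneg _)
      linarith
    have h3 : |K₃| ≤ cPhi w B * T / 2 := by
      have := (div_le_iff₀ hCΦ).mp hTK₃
      nlinarith
    have h4 := (abs_le.mp h1).1
    linarith
  have hW0pos : 0 < weightHat w B T 0 := lt_of_lt_of_le (by positivity) hW0
  have hI0R_eq := I0R_eq_diag w B r hT0 hsep
  have hS_eq := primeSum_eq_diag c w B r hT0 hsep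
  simp only [gapWidth] at hS_eq
  have hnorm := normSum_eq b r hr_on
  have hdiag := diagSum_eq b r (h := 2 * π * c / Real.log T) hr_on
  -- `I₀ ≥ 1`
  have hLr_le : (L : ℝ) ≤ cPhi w B * T / 2 := by
    have h1 : T ^ (1 - δ) * (2 / cPhi w B) ≤ T ^ (1 - δ) * T ^ δ :=
      mul_le_mul_of_nonneg_left hTδ' hpow0.le
    rw [hsplit, ← mul_div_assoc, div_le_iff₀ hCΦ] at h1
    linarith
  have hL0r : (0 : ℝ) < L := by linarith
  have hI0R_ge : 1 ≤ I0R w B r L T := by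
    rw [hI0R_eq]
    have h1 : 1 / (cPhi w B * T / 2) ≤ 1 / (L : ℝ) := one_div_le_one_div_of_le hL0r hLr_le
    calc (1 : ℝ) = (cPhi w B * T / 2) * (1 / (cPhi w B * T / 2)) := by field_simp
      _ ≤ weightHat w B T 0 * ∑ n ∈ Finset.Icc 1 L, r n ^ 2 / n :=
          mul_le_mul hW0 (h1.trans hr_low) (by positivity) hW0pos.le
  have hI0R_pos : 0 < I0R w B r L T := by linarith
  -- the key inequality `c I₀ − (2/π) S ≤ (1 − η) I₀`
  obtain ⟨M, hM⟩ : ∃ M : ℝ,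
      M = (InoueKobayashiToma2025.moForm (fun n => (b n : ℂ)) L (2 * π * c / Real.log T)).re :=
    ⟨_, rfl⟩
  obtain ⟨Nb, hNb_eq⟩ : ∃ Nb : ℝ, Nb = coeffNormSq (fun n => (b n : ℂ)) L := ⟨_, rfl⟩
  obtain ⟨W0, hW0_eq⟩ : ∃ W0 : ℝ, W0 = weightHat w B T 0 := ⟨_, rfl⟩
  rw [← hM, ← hNb_eq] at hmb
  rw [← hNb_eq] at hNb hnorm
  rw [← hM] at hdiag
  rw [← hW0_eq] at hW0 hW0pos hI0R_eq hS_eq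
  have hMN : c * Nb - M ≤ (1 - η) * Nb := by
    have h1 : c - (1 - η) ≤ M / Nb := by linarith
    rw [le_div_iff₀ hNb] at h1
    linarith
  have hkey : c * I0R w B r L T - 2 / π * primeSum c w B r L T ≤ (1 - η) * I0R w B r L T := by
    rw [hI0R_eq, hS_eq, hnorm, hdiag]
    have hpos : 0 ≤ W0 * lam ^ 2 := by positivity
    have h2 : 2 / π * (W0 * (lam ^ 2 * (π / 2) * M)) = W0 * lam ^ 2 * M := by
      field_simp
    rw [h2]
    have h3 := mul_le_mul_of_nonneg_left hMN hpos
    have h4 : W0 * lam ^ 2 * ((1 - η) * Nb) = (1 - η) * (W0 * (lam ^ 2 * Nb)) := by ring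
    have h5 : W0 * lam ^ 2 * (c * Nb - M) = c * (W0 * (lam ^ 2 * Nb)) - W0 * lam ^ 2 * M := by
      ring
    linarith
  -- (4) Proposition 1 (window constant `c ≥ 1`) at this `T`
  have hLT : (L : ℝ) ≤ T ^ (1 : ℝ) := by rw [Real.rpow_one]; exact hLle.trans hpow_le_T
  have hP1 := hT₁ T hT₁' (L : ℝ) hL1r hLT r hr_bd
  have hTinv : T ^ (-(1 : ℝ)) = T⁻¹ := Real.rpow_neg_one T
  have hinv_bound : ∀ K : ℝ, 8 * |K| / η ≤ T → K * T ^ (-(1 : ℝ)) ≤ η / 8 := by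
    intro K hK
    rw [hTinv]
    have h1 : K * T⁻¹ ≤ |K| * T⁻¹ := mul_le_mul_of_nonneg_right (le_abs_self _) (by positivity)
    have h2 : |K| * T⁻¹ ≤ η / 8 := by
      rw [← div_eq_mul_inv, div_le_iff₀ hT0]
      have := (div_le_iff₀ hη).mp hK
      linarith
    linarith
  have hK₁T := hinv_bound K₁ hTK₁
  have hI1R : I1R c w B r L T ≤ (1 - η / 2) * I0R w B r L T := by
    have h := (abs_le.mp hP1).2
    have hεI : c * ε * I0R w B r L T ≤ η / 8 * I0R w B r L T :=
      mul_le_mul_of_nonneg_right hεη hI0R_pos.le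
    have hηI : η / 8 ≤ η / 8 * I0R w B r L T := le_mul_of_one_le_right (by positivity) hI0R_ge
    linarith
  -- the extension to the window: `𝓘₁ < 𝓘₀`
  obtain ⟨hI0pos, hExt⟩ := hKE T hT₂' (L : ℝ) hL1r hLT r hr_bd hI0R_ge
  have hKET := hinv_bound KE hTKE
  have hratioR : I1R c w B r L T / I0R w B r L T ≤ 1 - η / 2 := by
    rw [div_le_iff₀ hI0R_pos]; exact hI1R
  have hratio : I1 c ε w B r L T / I0 ε w B r L T < 1 := by
    have := (abs_le.mp hExt).2
    linarith
  have hI : I1 c ε w B r L T < I0 ε w B r L T := (div_lt_one hI0pos).mp hratio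
  -- (5) but the windows are all occupied: `𝓘₀ ≤ 𝓘₁`
  have hTε : Real.sqrt T ≤ T ^ (1 - ε) := by
    rw [Real.sqrt_eq_rpow]
    exact Real.rpow_le_rpow_of_exponent_le hT1.le (by linarith)
  have hγN1 : zetaOrdinate N + 1 ≤ T ^ (1 - ε) := (Real.le_sqrt_of_sq_le hγN).trans hTε
  have h14 : (14 : ℝ) < zetaOrdinate 0 := fourteen_lt_zetaOrdinate_zero_holds
  have hexp2 : Real.exp 2 < 9 := by
    have h1 : Real.exp 2 = Real.exp 1 ^ 2 := by
      rw [← Real.exp_nat_mul]; norm_num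
    have h2 : Real.exp 1 < 3 := by
      have := Real.exp_one_lt_d9; norm_num at this; linarith
    have h3 : Real.exp 1 ^ 2 < 3 ^ 2 := pow_lt_pow_left₀ h2 (Real.exp_pos 1).le (by norm_num)
    rw [h1]; linarith [h3]
  -- `T^{1−ε} − 1/2 − πc ≥ T^{θ'/c}`
  have hpowθ : T ^ (θ' / c) ≤ T ^ (1 - ε) - 1 / 2 - π * c := by
    have h1 : T ^ (1 - ε) = T ^ (θ' / c) * T ^ κ := by
      rw [← Real.rpow_add hT0]; congr 1; rw [hκ_def]; ring
    have h2 : (1 : ℝ) ≤ T ^ (θ' / c) := Real.one_le_rpow hT1.le (by positivity)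
    have h3 : T ^ (θ' / c) * (1 / 2 + π * c) ≤ T ^ (θ' / c) * (T ^ κ - 1) :=
      mul_le_mul_of_nonneg_left (by linarith) (by positivity)
    have h3' : T ^ (θ' / c) * (T ^ κ - 1) = T ^ (θ' / c) * T ^ κ - T ^ (θ' / c) := by ring
    have h4 : 1 / 2 + π * c ≤ T ^ (θ' / c) * (1 / 2 + π * c) :=
      le_mul_of_one_le_left (by positivity) h2
    rw [h1]; linarith
  have hfill : ∀ t ∈ Set.Icc (T ^ (1 - ε)) (T ^ (1 + ε)), 1 ≤ windowCount (gapWidth c T) t := by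
    intro t ht
    have ht1 : T ^ (1 - ε) ≤ t := ht.1
    refine one_le_windowCount_of_gaps (N := N) (by linarith) fun n hn _ hγup ↦ ?_
    -- the gap at `γ_n`, `n ≥ N`: `δ_n < θ'`, i.e. `γ_{n+1} − γ_n < 2πθ'/log γ_n`
    have hδn := hN n hn
    have hγn14 : 14 < zetaOrdinate n :=
      lt_of_lt_of_le h14 (zetaOrdinate_mono_holds (Nat.zero_le n))
    have hlogγ : 2 < Real.log (zetaOrdinate n) := by
      rw [Real.lt_log_iff_exp_lt (by linarith)]
      linarith [hexp2]
    have hlogγ0 : 0 < Real.log (zetaOrdinate n) := by linarith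
    rw [zetaNormalizedGap_eq_mul_div, div_lt_iff₀ (by positivity)] at hδn
    have hgap1 : zetaOrdinate (n + 1) - zetaOrdinate n <
        2 * π * θ' / Real.log (zetaOrdinate n) := by
      rw [lt_div_iff₀ hlogγ0]; linarith
    -- lower bound `γ_n > γ_{n+1} − πθ' > T^{1−ε} − 1/2 − πc ≥ T^{θ'/c}`
    have hgap2 : 2 * π * θ' / Real.log (zetaOrdinate n) ≤ π * θ' := by
      rw [div_le_iff₀ hlogγ0]
      have := mul_le_mul_of_nonneg_left hlogγ.le (by positivity : (0 : ℝ) ≤ π * θ')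
      linarith
    have hγn_low : T ^ (θ' / c) < zetaOrdinate n := by
      have h1 : gapWidth c T / 2 ≤ 1 / 2 := by linarith
      have h2 : π * θ' ≤ π * c := mul_le_mul_of_nonneg_left hθ'c.le Real.pi_pos.le
      linarith
    have hlogγn : θ' / c * Real.log T ≤ Real.log (zetaOrdinate n) := by
      rw [← Real.log_rpow hT0]
      exact Real.log_le_log (Real.rpow_pos_of_pos hT0 _) hγn_low.le
    -- hence `2πθ'/log γ_n ≤ 2πc/log T = h`
    have hcmp : 2 * π * θ' / Real.log (zetaOrdinate n) ≤ gapWidth c T := by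
      unfold gapWidth
      rw [div_le_div_iff₀ hlogγ0 hlogT]
      have h1 : θ' * Real.log T ≤ c * Real.log (zetaOrdinate n) := by
        have := mul_le_mul_of_nonneg_left hlogγn hc.le
        rwa [← mul_assoc, mul_div_cancel₀ _ hc.ne'] at this
      have h2 := mul_le_mul_of_nonneg_left h1 (by positivity : (0 : ℝ) ≤ 2 * π)
      linarith
    linarith
  have hI' : I0 ε w B r L T ≤ I1 c ε w B r L T :=
    I0_le_I1_of_one_le_windowCount hT0 hh0.le (by linarith) hfill
  exact absurd hI (not_lt.mpr hI')

end Literature.NumberTheory.LFunctions
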